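import Mathlib
import HarnessLib
import Summits.ValiantsHypothesis.ValiantsHypothesis.Theses.MonotoneRestoration
import Literature.Computability.AlgebraicComplexity.SymmetricCircuitGradientSymmetry

/-! # Route MonotoneRestoration — crux `MonotoneRestorationQP`, line Sketch, stub Z7
(stmt-ValiantsHypothesis-15886)

**Gradients of symmetric circuits (forward mode).** THEOREM ζ of line Sketch v10 is the size
calculus of Dawar–Wilsenach square-symmetric circuits; Z7 is its closure under GRADIENTS,
equivariantly: the partial derivatives `(∂f/∂x)_{x ∈ X}` of a `Γ`-symmetrically computed `f`
are computed by ONE `Γ`-symmetric labelled circuit with outputs indexed by the variable set `X`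
(`Γ` acting on the output indices as on the variables), on at most `(|G| + 1)² (|X| + 1) + 2`
gates.

Proof: the universe-`0` instance of the tree lemma
`LabelledArithCircuit.IsSymmetric.exists_gradient`
(`Literature/Computability/AlgebraicComplexity/SymmetricCircuitGradientSymmetry.lean`, the
construction being `LabelledArithCircuit.Gradient.gradCircuit` of
`SymmetricCircuitGradient.lean`): forward-mode differentiation — for every gate `g` and
variable `x` an addition gate `der g x` of value `∂_x v_g` (unary over the source of `1`/`0`
for inputs, the sum of the `der h x` over the children `h` of a sum gate, and the sum over the
children `h` of a product gate of the Leibniz summands `term g h x = der h x × ∏_{h' ≠ h} h'`),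
the constants `0, 1` sourced from existing constant gates when present (Def. 2.2); an
automorphism `π` over `γ` extends by `der g x ↦ der (π g) (γ • x)`,
`term g h x ↦ term (π g) (π h) (γ • x)`.
-/

noncomputable section

-- `Summit.ValiantsHypothesis.ValiantsHypothesis.…` is the tree's mandated namespace (Sub = Summit).
set_option linter.dupNamespace false

namespace Summit.ValiantsHypothesis.ValiantsHypothesis.Theorems

open Literature.Computability.AlgebraicComplexity

/-- **Z7 — gradients of symmetric circuits, forward mode** (crux `MonotoneRestorationQP`, line
Sketch; registered stub `stub_symmetric_forwardGradient`): a `Γ`-symmetric single-output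
labelled circuit `C` over `K` and the finite `Γ`-set of variables `X` yields a `Γ`-symmetric
labelled circuit with outputs indexed by `X` whose output `x` computes
`MvPolynomial.pderiv x` of the polynomial computed by `C`, on at most `(|G| + 1)² (|X| + 1) + 2`
gates. Instance of `LabelledArithCircuit.IsSymmetric.exists_gradient`. -/
theorem stub_symmetric_forwardGradient {K X Γ G : Type} [CommSemiring K] [Group Γ]
    [MulAction Γ X] [MulAction Γ Unit] [Fintype X] [DecidableEq X] [Fintype G]
    (C : LabelledArithCircuit K X Unit G) (hC : C.IsSymmetric Γ) :
    ∃ (G' : Type) (_ : Fintype G') (C' : LabelledArithCircuit K X X G'),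
      C'.IsSymmetric Γ ∧
      (∀ x, C'.eval (C'.output x) = MvPolynomial.pderiv x (C.eval (C.output ()))) ∧
      Fintype.card G' ≤ (Fintype.card G + 1) ^ 2 * (Fintype.card X + 1) + 2 :=
  hC.exists_gradient

end Summit.ValiantsHypothesis.ValiantsHypothesis.Theorems

end
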